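import Mathlib.Algebra.Group.ForwardDiff
import Mathlib.Algebra.Order.Interval.Finset.Basic
import Mathlib.Analysis.SpecialFunctions.Trigonometric.Basic
import Mathlib.Analysis.Complex.Trigonometric
import Mathlib.Analysis.Normed.Module.Basic
import HarnessLib

/-!
# Summation by parts for finitely supported Matsubara sums (positive-temperature propagator decay in `x₀`)

Topic `Literature/Analysis/Fourier`.  At inverse temperature `β` the time variable of a fermionic
propagator is carried by the sum over the Matsubara frequencies `k₀(j) = π(2j+1)/β`, `j ∈ ℤ`, of
`e^{-ik₀(j)x₀} Ĝ(j)`, and its decay in `x₀` is obtained "integrating by parts" in `k₀`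
(Benfatto–Giuliani–Mastropietro 2006, Lemma 2.2 (2.52)/(2.56): the decay factor is
`d_β(x₀) = (β/π) sin(πx₀/β)`, and BGM's discrete derivative (2.36aa) is
`∂_{k₀}Ĝ = (β/2π)[Ĝ(k₀ + 2π/β) - Ĝ(k₀)]`).  The mechanism is the elementary identity, for a phase
progression `c(j) = e^{-i(a + δj)x}` (`c(j+1) = e^{-iδx}c(j)`) and a finitely supported `Ĝ : ℤ → E`,

  `(e^{-iδx} - 1) Σ_j c(j) Ĝ(j) = Σ_j c(j) [Ĝ(j-1) - Ĝ(j)]`,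

iterated `N` times, together with `‖e^{-iδx} - 1‖ = 2|sin(δx/2)|`; for `a = π/β`, `δ = 2π/β` this is
`(2π/β)|d_β(x₀)|`, so that `((2π/β)|d_β(x₀)|)^N ‖Σ_j e^{-ik₀(j)x₀}Ĝ(j)‖ ≤ Σ_j ‖(∇^N Ĝ)(j)‖` with the
backward difference `∇Ĝ(j) = Ĝ(j-1) - Ĝ(j)` — Mathlib's `fwdDiff (-1) Ĝ`.  The companion file
`DiscreteSummationByParts.lean` is the same computation on the finite torus `ℤ/Lℤ` (Mastropietro 2008,
Lemma 3.2); here the index set is `ℤ` and the sums are written as `Finset` sums over an interval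
`Icc A B` containing the support (the form in which a scale-`h` propagator, supported on
`|k₀| ≤ O(γ^h)`, is summed), the `N`-th difference being supported in `Icc A (B + N)`.

PROVED here (no definitions, no named facts):

* `fwdDiff_neg_one_apply` — `fwdDiff (-1) Ĝ j = Ĝ (j-1) - Ĝ j`; `fwdDiff_neg_one_eq_zero`,
  `fwdDiff_iter_neg_one_eq_zero` — the `N`-th backward difference of a function vanishing off
  `Icc A B` vanishes off `Icc A (B + N)`;
* `cexp_phase_succ` — `c(j+1) = e^{-iδx} c(j)`; `norm_cexp_neg_I_mul_ofReal` — `‖c(j)‖ = 1`;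
* **`sub_one_smul_sum_phase`** — the summation-by-parts identity above, and its iterate
  **`sub_one_pow_smul_sum_phase`** — `(e^{-iδx} - 1)^N Σ_{Icc A B} c Ĝ = Σ_{Icc A (B+N)} c ∇ᴺĜ`;
* `norm_cexp_neg_mul_sub_one` — `‖e^{-iδx} - 1‖ = 2|sin(δx/2)|`;
* **`pow_mul_norm_sum_phase_le`** — `(2|sin(δx/2)|)^N ‖Σ_{Icc A B} c Ĝ‖ ≤ Σ_{Icc A (B+N)} ‖∇ᴺĜ‖`;
* the Matsubara specialisation (`a = π/β`, `δ = 2π/β`): `matsubara_phase_eq`,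
  `two_mul_abs_sin_eq_dbeta` (`2|sin(πx₀/β)| = (2π/β)|d_β(x₀)|`) and
  **`dbeta_pow_mul_norm_matsubara_sum_le`** —
  `((2π/β)|(β/π) sin(πx₀/β)|)^N ‖Σ_{j ∈ Icc A B} e^{-iπ(2j+1)x₀/β} Ĝ(j)‖ ≤ Σ_{j ∈ Icc A (B+N)} ‖(∇ᴺĜ)(j)‖`.

## Sources

G. Benfatto, A. Giuliani, V. Mastropietro, Ann. Henri Poincaré **7** (2006) 809–898 =
arXiv:cond-mat/0507686, §2.3 (2.36aa), §2.5 Lemma 2.2 (2.52), proof (2.56) (render p0010:L107–p0011:L33)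
[BenfattoGiulianiMastropietro2006]; V. Mastropietro, *Non-Perturbative Renormalization* (2008), Lemma 3.2
(3.19) [Mastropietro2008].  The lemmas themselves are routine ("folklore").
-/

noncomputable section

open Finset Complex
open scoped Real

namespace Literature.Analysis.Fourier

section Support

variable {E : Type*} [AddCommGroup E]

/-! ### The backward difference `∇ = fwdDiff (-1)` on `ℤ` and its support -/

/-- `fwdDiff (-1) Ĝ j = Ĝ (j - 1) - Ĝ j` (the backward difference; BGM's discrete derivative (2.36aa) up to
the step normalisation `β/2π`). [cite: BenfattoGiulianiMastropietro2006, §2.3 (2.36aa) p0008:L55] -/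
theorem fwdDiff_neg_one_apply (G : ℤ → E) (j : ℤ) : fwdDiff (-1 : ℤ) G j = G (j - 1) - G j := by
  rw [fwdDiff, sub_eq_add_neg j 1]

/-- If `Ĝ` vanishes off `Icc A B` then `∇Ĝ` vanishes off `Icc A (B + 1)` (support bookkeeping of the
discrete derivative (2.36aa)). [cite: BenfattoGiulianiMastropietro2006, §2.3 (2.36aa) p0008:L55] -/
theorem fwdDiff_neg_one_eq_zero {G : ℤ → E} {A B : ℤ} (hG : ∀ j, j ∉ Icc A B → G j = 0) (j : ℤ)
    (hj : j ∉ Icc A (B + 1)) : fwdDiff (-1 : ℤ) G j = 0 := by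
  rw [fwdDiff_neg_one_apply]
  have h1 : G (j - 1) = 0 := hG _ fun h => hj (by rw [mem_Icc] at h ⊢; omega)
  have h2 : G j = 0 := hG _ fun h => hj (by rw [mem_Icc] at h ⊢; omega)
  rw [h1, h2, sub_zero]

/-- If `Ĝ` vanishes off `Icc A B` then `∇ᴺĜ` vanishes off `Icc A (B + N)` (support bookkeeping of the
iterated discrete derivative (2.36aa)). [cite: BenfattoGiulianiMastropietro2006, §2.3 (2.36aa) p0008:L55] -/
theorem fwdDiff_iter_neg_one_eq_zero :
    ∀ (N : ℕ) {G : ℤ → E} {A B : ℤ}, (∀ j, j ∉ Icc A B → G j = 0) →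
      ∀ j, j ∉ Icc A (B + N) → ((fwdDiff (-1 : ℤ))^[N] G) j = 0
  | 0, G, A, B, hG, j, hj => by simpa using hG j (by simpa using hj)
  | N + 1, G, A, B, hG, j, hj => by
    rw [Function.iterate_succ_apply]
    refine fwdDiff_iter_neg_one_eq_zero N (fwdDiff_neg_one_eq_zero hG) j ?_
    rwa [add_assoc, add_comm (1 : ℤ)]

end Support

/-! ### The phase progression `c(j) = e^{-i(a + δ j)x}` -/

/-- `c(j+1) = e^{-iδx} c(j)` for `c(j) = e^{-i(a + δj)x}` (the phase progression of the Matsubara sum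
(2.49), `k₀(j+1) = k₀(j) + 2π/β`). [cite: BenfattoGiulianiMastropietro2006, §2.5 (2.49) p0010:L72] -/
theorem cexp_phase_succ (a δ x : ℝ) (j : ℤ) :
    cexp (-(I * (((a + δ * ((j + 1 : ℤ) : ℝ)) * x : ℝ) : ℂ))) =
      cexp (-(I * ((δ * x : ℝ) : ℂ))) * cexp (-(I * (((a + δ * (j : ℝ)) * x : ℝ) : ℂ))) := by
  rw [← Complex.exp_add]
  congr 1
  push_cast
  ring

/-- `‖c(j)‖ = 1`: the phases of (2.49) are unimodular. [cite: BenfattoGiulianiMastropietro2006, §2.5 (2.49) p0010:L72] -/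
theorem norm_cexp_neg_I_mul_ofReal (t : ℝ) : ‖cexp (-(I * (t : ℂ)))‖ = 1 := by
  rw [show -(I * (t : ℂ)) = ((-t : ℝ) : ℂ) * I by push_cast; ring, Complex.norm_exp_ofReal_mul_I]

/-- `‖e^{-iδx} - 1‖ = 2|sin(δx/2)|` (the origin of `d_L(x) = sin(πx/L)` in Mastropietro's (3.19) and of
`d_β(x₀)` in BGM's (2.52)). [cite: Mastropietro2008, Lemma 3.2 (3.19)] -/
theorem norm_cexp_neg_mul_sub_one (δ x : ℝ) :
    ‖cexp (-(I * ((δ * x : ℝ) : ℂ))) - 1‖ = 2 * |Real.sin (δ * x / 2)| := by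
  have h : -(I * ((δ * x : ℝ) : ℂ)) = I * ((-(δ * x) : ℝ) : ℂ) := by push_cast; ring
  rw [h, Complex.norm_exp_I_mul_ofReal_sub_one, Real.norm_eq_abs, abs_mul, abs_two, neg_div,
    Real.sin_neg, abs_neg]

/-! ### Summation by parts -/

/-- A sum over `Icc A B` of a function vanishing off `Icc A B` may be taken over any larger interval
(the Matsubara sum (2.49) restricted to the support of `f_h`, (2.42a)). [cite: BenfattoGiulianiMastropietro2006, §2.5 (2.49) p0010:L72] -/
theorem sum_Icc_eq_sum_Icc_of_subset {E : Type*} [AddCommMonoid E] {F : ℤ → E} {A B A' B' : ℤ}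
    (hF : ∀ j, j ∉ Icc A B → F j = 0) (hA : A' ≤ A) (hB : B ≤ B') :
    ∑ j ∈ Icc A B, F j = ∑ j ∈ Icc A' B', F j :=
  sum_subset (Icc_subset_Icc hA hB) fun j _ hj => hF j hj

section Phase

variable {E : Type*} [NormedAddCommGroup E] [NormedSpace ℂ E]

/-- **Summation by parts on `ℤ`**: for `Ĝ` vanishing off `Icc A B`,
`(e^{-iδx} - 1) Σ_{j ∈ Icc A B} e^{-i(a+δj)x} Ĝ(j) = Σ_{j ∈ Icc A (B+1)} e^{-i(a+δj)x} [Ĝ(j-1) - Ĝ(j)]`.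
[cite: BenfattoGiulianiMastropietro2006, §2.5 proof of Lemma 2.2 (2.56) p0011:L25] -/
theorem sub_one_smul_sum_phase (G : ℤ → E) {A B : ℤ} (hG : ∀ j, j ∉ Icc A B → G j = 0) (a δ x : ℝ) :
    (cexp (-(I * ((δ * x : ℝ) : ℂ))) - 1) •
        ∑ j ∈ Icc A B, cexp (-(I * (((a + δ * (j : ℝ)) * x : ℝ) : ℂ))) • G j =
      ∑ j ∈ Icc A (B + 1), cexp (-(I * (((a + δ * (j : ℝ)) * x : ℝ) : ℂ))) • fwdDiff (-1 : ℤ) G j := by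
  -- the shifted sum `Σ_{Icc A (B+1)} c(j) Ĝ(j-1) = e^{-iδx} Σ_{Icc A B} c(j) Ĝ(j)`
  have hshift : ∑ j ∈ Icc A (B + 1), cexp (-(I * (((a + δ * (j : ℝ)) * x : ℝ) : ℂ))) • G (j - 1) =
      cexp (-(I * ((δ * x : ℝ) : ℂ))) • ∑ j ∈ Icc A B, cexp (-(I * (((a + δ * (j : ℝ)) * x : ℝ) : ℂ))) • G j := by
    have hmap : (Icc (A - 1) B).map (addRightEmbedding 1) = Icc A (B + 1) := by
      rw [map_add_right_Icc, sub_add_cancel]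
    rw [← hmap, sum_map]
    simp only [addRightEmbedding_apply, add_sub_cancel_right, cexp_phase_succ, mul_smul, ← smul_sum]
    congr 1
    symm
    refine sum_Icc_eq_sum_Icc_of_subset
      (F := fun i : ℤ => cexp (-(I * (((a + δ * (i : ℝ)) * x : ℝ) : ℂ))) • G i) (fun j hj => ?_) (by omega) le_rfl
    simp only [hG j hj, smul_zero]
  have hplain : ∑ j ∈ Icc A (B + 1), cexp (-(I * (((a + δ * (j : ℝ)) * x : ℝ) : ℂ))) • G j =
      ∑ j ∈ Icc A B, cexp (-(I * (((a + δ * (j : ℝ)) * x : ℝ) : ℂ))) • G j := by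
    symm
    refine sum_Icc_eq_sum_Icc_of_subset
      (F := fun i : ℤ => cexp (-(I * (((a + δ * (i : ℝ)) * x : ℝ) : ℂ))) • G i) (fun j hj => ?_) le_rfl (by omega)
    simp only [hG j hj, smul_zero]
  simp only [fwdDiff_neg_one_apply, smul_sub, sum_sub_distrib, sub_smul, one_smul]
  rw [hshift, hplain]

/-- **Iterated summation by parts**: `(e^{-iδx} - 1)^N Σ_{Icc A B} c Ĝ = Σ_{Icc A (B+N)} c ∇ᴺĜ`.
[cite: BenfattoGiulianiMastropietro2006, §2.5 proof of Lemma 2.2 (2.56) p0011:L25] -/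
theorem sub_one_pow_smul_sum_phase :
    ∀ (N : ℕ) (G : ℤ → E) {A B : ℤ}, (∀ j, j ∉ Icc A B → G j = 0) → ∀ (a δ x : ℝ),
      (cexp (-(I * ((δ * x : ℝ) : ℂ))) - 1) ^ N •
          ∑ j ∈ Icc A B, cexp (-(I * (((a + δ * (j : ℝ)) * x : ℝ) : ℂ))) • G j =
        ∑ j ∈ Icc A (B + N), cexp (-(I * (((a + δ * (j : ℝ)) * x : ℝ) : ℂ))) •
          ((fwdDiff (-1 : ℤ))^[N] G) j
  | 0, G, A, B, _, a, δ, x => by simp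
  | N + 1, G, A, B, hG, a, δ, x => by
    rw [pow_succ, mul_smul, sub_one_smul_sum_phase G hG a δ x,
      sub_one_pow_smul_sum_phase N (fwdDiff (-1 : ℤ) G) (fwdDiff_neg_one_eq_zero hG) a δ x,
      Function.iterate_succ_apply]
    push_cast
    rw [add_assoc, add_comm (1 : ℤ)]

/-- `‖Σ_j c(j) F(j)‖ ≤ Σ_j ‖F(j)‖` (the phases are unimodular; Mastropietro (3.19)→(3.20)). [cite: Mastropietro2008, Lemma 3.2 (3.19)] -/
theorem norm_sum_phase_smul_le (F : ℤ → E) (S : Finset ℤ) (a δ x : ℝ) :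
    ‖∑ j ∈ S, cexp (-(I * (((a + δ * (j : ℝ)) * x : ℝ) : ℂ))) • F j‖ ≤ ∑ j ∈ S, ‖F j‖ := by
  refine (norm_sum_le _ _).trans (sum_le_sum fun j _ => ?_)
  rw [norm_smul, norm_cexp_neg_I_mul_ofReal, one_mul]

/-- **The decay bound in the phase variable**: for `Ĝ` vanishing off `Icc A B`,
`(2|sin(δx/2)|)^N ‖Σ_{j ∈ Icc A B} e^{-i(a+δj)x} Ĝ(j)‖ ≤ Σ_{j ∈ Icc A (B+N)} ‖(∇ᴺĜ)(j)‖`.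
[cite: BenfattoGiulianiMastropietro2006, §2.5 proof of Lemma 2.2 (2.56) p0011:L25] -/
theorem pow_mul_norm_sum_phase_le (N : ℕ) (G : ℤ → E) {A B : ℤ} (hG : ∀ j, j ∉ Icc A B → G j = 0)
    (a δ x : ℝ) :
    (2 * |Real.sin (δ * x / 2)|) ^ N * ‖∑ j ∈ Icc A B, cexp (-(I * (((a + δ * (j : ℝ)) * x : ℝ) : ℂ))) • G j‖ ≤
      ∑ j ∈ Icc A (B + N), ‖((fwdDiff (-1 : ℤ))^[N] G) j‖ := by
  rw [← norm_cexp_neg_mul_sub_one, ← norm_pow, ← norm_smul, sub_one_pow_smul_sum_phase N G hG a δ x]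
  exact norm_sum_phase_smul_le _ _ a δ x

/-! ### The Matsubara specialisation `a = π/β`, `δ = 2π/β` -/

/-- `π/β + (2π/β) j = π(2j+1)/β`: the phase progression with `a = π/β`, `δ = 2π/β` runs over the
fermionic Matsubara frequencies. [cite: BenfattoGiulianiMastropietro2006, §1 (1.4)(b)] -/
theorem matsubara_phase_eq (β : ℝ) (j : ℤ) : π / β + 2 * π / β * (j : ℝ) = π * (2 * (j : ℝ) + 1) / β := by
  ring

/-- `2|sin(πx₀/β)| = (2π/β)|d_β(x₀)|` with `d_β(x₀) = (β/π) sin(πx₀/β)` (`β > 0`).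
[cite: BenfattoGiulianiMastropietro2006, §2.5 Lemma 2.2 (2.52)] -/
theorem two_mul_abs_sin_eq_dbeta {β : ℝ} (hβ : 0 < β) (x₀ : ℝ) :
    2 * |Real.sin (2 * π / β * x₀ / 2)| = 2 * π / β * |β / π * Real.sin (π * x₀ / β)| := by
  have hπ : 0 < π := Real.pi_pos
  rw [abs_mul, abs_of_pos (div_pos hβ hπ), show 2 * π / β * x₀ / 2 = π * x₀ / β by ring]
  field_simp

/-- **Matsubara summation by parts** (the `x₀`-decay mechanism of BGM 2006 Lemma 2.2 / 2.3 at inverse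
temperature `β`): for `Ĝ : ℤ → E` vanishing off `Icc A B` and every `N`,
`((2π/β)|(β/π)sin(πx₀/β)|)^N ‖Σ_{j ∈ Icc A B} e^{-iπ(2j+1)x₀/β} Ĝ(j)‖ ≤ Σ_{j ∈ Icc A (B+N)} ‖(∇ᴺĜ)(j)‖`,
`∇Ĝ(j) = Ĝ(j-1) - Ĝ(j)`. [cite: BenfattoGiulianiMastropietro2006, §2.5 proof of Lemma 2.2 (2.56) p0011:L25] -/
theorem dbeta_pow_mul_norm_matsubara_sum_le {β : ℝ} (hβ : 0 < β) (N : ℕ) (G : ℤ → E) {A B : ℤ}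
    (hG : ∀ j, j ∉ Icc A B → G j = 0) (x₀ : ℝ) :
    (2 * π / β * |β / π * Real.sin (π * x₀ / β)|) ^ N *
        ‖∑ j ∈ Icc A B, cexp (-(I * ((π * (2 * (j : ℝ) + 1) / β * x₀ : ℝ) : ℂ))) • G j‖ ≤
      ∑ j ∈ Icc A (B + N), ‖((fwdDiff (-1 : ℤ))^[N] G) j‖ := by
  have h := pow_mul_norm_sum_phase_le N G hG (π / β) (2 * π / β) x₀
  simp only [matsubara_phase_eq, two_mul_abs_sin_eq_dbeta hβ] at h
  exact h

end Phase

end Literature.Analysis.Fourier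

end
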